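import Summits.QuantumFields.YangMills.Theorems.BalabanLadderNTWeakPackageNestedCovariance
import Summits.QuantumFields.YangMills.Theorems.BalabanLadderNTBoundaryLawOscillation
import Summits.QuantumFields.YangMills.Theorems.BalabanLadderNTWeakPackageCollar
import HarnessLib

/-!
# Crux `NT` (stmt-QuantumFields-19353), stub `stub_cfpw : CFPW`: the two-point floor clause (F) on SPARSE radii

Helper file (`--supports stmt-QuantumFields-19353`) of the fleet lead prover of crux `NT` (unit `ym-spine-19353-p1`,
g3); an unconditional reduction on the ENGINE side of the registered stub `stub_cfpw : CFPW` (skeleton v3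
«weak-package», 374f16092bb0c203), companion of `…BoundaryLawOscillation` (same seat: the boundary law `FBL` on a
covering set of radii suffices).

The weak floor clause (F) of `CFPW` (text: `Theorems/BalabanLadderNTWeakPackage.lean`, hypothesis `hF` of
`lowerBounds_of_weakPackage`; antitone single-collar form: `WeakPackage.floorClause_of_antitoneCollar`) asks for the
conditional two-point floor `c₂ Γ(‖y−x‖ a) ≤ ‖y−x‖⁸ · kerCov_{Q,η}(dens x, dens y)` on EVERY x-centred femto cube
`Q = [x−R, x+R]⁴` holding `y` at depth `≥ K · ‖y−x‖`.  A multiscale engine proves such statements on ITS OWN cube sizes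
(`L^k M`).  This file shows that suffices, given the boundary law:

* `kerCov_ge_of_nested` — **law of total covariance through a nested sub-cube, as a floor**: for cubes `Q₀ ⊆ Q`, if the
  `Q₀`-conditional covariance of `F, G'` is `≥ m` for every exterior and the `Q₀`-kernel means of `F`, `G'` are within
  `h`, `h'` of constants, then `kerCov_{Q,η}(F, G') ≥ m − 4 h h'` for every exterior `η` of `Q` (consistency
  `kerE_kerE_of_subset` + the tree's `sub_mul_mul_le_cov_of_kernel`);
* `floorClause_of_cover` — `FBL G r a` and the floor clause on the x-centred cubes of radii `R₀ ∈ S`, `S` covering every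
  radius up to a factor `θ ≥ 1` (`∀ R ≥ D, ∃ R₀ ∈ S, R₀ ≤ R, R+1 ≤ θ (R₀+1)`), with an antitone collar `K`, a shape `Γ`
  that is POSITIVE and MONOTONE on `(0, ℓ₂]` (as the engine's `Γ(s) ≍ g(s)⁴` is) and growth `Γ(s)/s⁸ → ∞`, imply the
  floor clause on ALL radii in the antitone single-collar form, with constant `c₂/2` and the enlarged collar
  `K'(s) = θ (K(s) + κ(s) + 1)`, `κ(s) = (8 C₁² / (c₂ Γ(s ∧ ℓ₂)))^{1/8}` (the depth at which the boundary-law term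
  `4 (C₁/d⁴)²` of the law of total covariance is half the signal; `s κ(s) → 0` BY the growth clause — this is exactly
  what the growth clause is for);
* `floorClause_of_cover'` — the same with the registered `∀ s₀` collar (via `floorClause_of_antitoneCollar`);
* `floorClause_of_seq` — along an unbounded sequence of radii with `R_{k+1} + 1 ≤ θ (R_k + 1)`.

Real-analysis lemmas: `eight_mul_sq_le_collar` (the absorption inequality), `tendsto_mul_collar` (`s κ(s) → 0` from
`Γ(s)/s⁸ → ∞`), `antitoneOn_collar`.  Refs: Georgii 2011 Def. 1.23 (iii); the registry texts cited above.
-/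

set_option autoImplicit false

noncomputable section

open MeasureTheory Filter Topology
open Literature.MathematicalPhysics.QuantumFieldTheory Literature.MathematicalPhysics.QuantumLattice
open Literature.Probability.LatticeModels
open Summit.QuantumFields.YangMills.Cruxes.OSLegsFromFemtoAndGap.DlrCollarTransfer
open Summit.QuantumFields.YangMills.Cruxes.OSLegsFromFemtoAndGap.DlrCollarTransfer.StubLower
  (exists_abs_dens_le le_depth_cube)
open Summit.QuantumFields.YangMills.Theorems.OSLegsFromFemtoAndGap.StubLower (sub_mul_mul_le_cov_of_kernel abs_apply_le_norm)
open Summit.QuantumFields.YangMills.Cruxes.NT.BoundaryLaw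
  (cubeSites_subset cubeEdges_subset kerE_kerE_of_subset abs_kerE_le cover_of_seq)

namespace Summit.QuantumFields.YangMills.Cruxes.NT.WeakPackage

/-! ## §4 The floor clause on a covering set of radii suffices -/

section Lattice

variable (G : Type) [Group G] [TopologicalSpace G] [IsTopologicalGroup G] [CompactSpace G]
  [MeasurableSpace G] [BorelSpace G] (r : LatticeRep G) (a : ℝ → ℝ)

/-- **The weak floor clause (F) from the floor on a covering set of radii, given `FBL`.**  Let `0 < a`, `FBL G r a`,
and `S ⊆ ℕ` cover every radius `R ≥ D` up to the factor `θ ≥ 1`.  Suppose the conditional two-point floor holds on the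
x-centred femto cubes of radii `R₀ ∈ S` — antitone collar `K ≥ 1` with `s K(s) → 0`, shape `Γ` positive and monotone
on `(0, ℓ₂]` with `Γ(s)/s⁸ → ∞`, for pairs in the forward cone with `‖y−x‖ ≥ n₀` and the single depth condition
`K(‖y−x‖ a) ‖y−x‖ ≤ depth y`.  Then the floor clause holds on ALL x-centred femto cubes, in the antitone single-collar
form of `floorClause_of_antitoneCollar`, with constant `c₂/2`, range `ℓ₂ ∧ ℓ₁`, threshold `n₀ ∨ (D+2)` and collar
`K'(s) = θ (K(s) + κ(s) + 1)`, `κ(s) = (max 0 (8C₁²/(c₂ Γ(s ∧ ℓ₂))))^{1/8}`.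

Proof: a pair at depth `≥ K'(s) ‖y−x‖` in the radius-`R` cube sits at depth `≥ (K(s) + κ(s)) ‖y−x‖` in the
radius-`R₀` cube (`R₀ ∈ S`, `R₀ ≤ R`, `R+1 ≤ θ(R₀+1)`); the floor there (every exterior) and the boundary law for the
two `R₀`-kernel means (`≤ C₁/((1+κ)‖y−x‖)⁴`) give, by the nested law of total covariance `kerCov_ge_of_nested`,
`kerCov_R ≥ c₂Γ/ν⁸ − 4C₁²/((1+κ)ν)⁸ ≥ (c₂/2) Γ/ν⁸` (`eight_mul_sq_le_collar`). [folklore] -/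
theorem floorClause_of_cover (ha : ∀ β, 0 < a β) (hFBL : FBL G r a) (S : Set ℕ) (θ : ℝ) (hθ : 1 ≤ θ) (D : ℕ)
    (hcover : ∀ R : ℕ, D ≤ R → ∃ R₀ ∈ S, R₀ ≤ R ∧ (R : ℝ) + 1 ≤ θ * ((R₀ : ℝ) + 1))
    (h : ∃ (Γ : ℝ → ℝ) (β₂ ℓ₂ c₂ : ℝ) (K : ℝ → ℝ) (n₀ : ℕ), 0 < ℓ₂ ∧ 0 < c₂ ∧ (∀ s, 1 ≤ K s) ∧
      AntitoneOn K (Set.Ioi 0) ∧ Tendsto (fun s : ℝ => s * K s) (nhdsWithin 0 (Set.Ioi 0)) (nhds 0) ∧ 1 ≤ n₀ ∧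
      Tendsto (fun s : ℝ => Γ s / s ^ 8) (nhdsWithin 0 (Set.Ioi 0)) atTop ∧
      (∀ s : ℝ, 0 < s → s ≤ ℓ₂ → 0 < Γ s) ∧ MonotoneOn Γ (Set.Ioc 0 ℓ₂) ∧
      ∀ β : ℝ, β₂ ≤ β → ∀ (x : Fin 4 → ℤ) (R₀ : ℕ), R₀ ∈ S → ((2 * R₀ + 1 : ℕ) : ℝ) * a β ≤ ℓ₂ →
        ∀ (η : LGConfig 4 G) (y : Fin 4 → ℤ), 0 < ‖siteToE (y - x)‖ * a β →
          (n₀ : ℝ) ≤ ‖siteToE (y - x)‖ → ‖siteToE (y - x)‖ < 3 * siteToE (y - x) 0 →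
            K (‖siteToE (y - x)‖ * a β) * ‖siteToE (y - x)‖ ≤ depth (fun j => x j - R₀) (2 * R₀ + 1) y →
              c₂ * Γ (‖siteToE (y - x)‖ * a β) ≤
                ‖siteToE (y - x)‖ ^ 8 *
                  kerCov G r β (fun j => x j - R₀) (2 * R₀ + 1) η (dens G r x) (dens G r y)) :
    ∃ (Γ : ℝ → ℝ) (β₂ ℓ₂ c₂ : ℝ) (K : ℝ → ℝ) (n₀ : ℕ), 0 < ℓ₂ ∧ 0 < c₂ ∧ (∀ s, 1 ≤ K s) ∧
      AntitoneOn K (Set.Ioi 0) ∧ Tendsto (fun s : ℝ => s * K s) (nhdsWithin 0 (Set.Ioi 0)) (nhds 0) ∧ 1 ≤ n₀ ∧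
      Tendsto (fun s : ℝ => Γ s / s ^ 8) (nhdsWithin 0 (Set.Ioi 0)) atTop ∧
      ∀ β : ℝ, β₂ ≤ β → ∀ (x : Fin 4 → ℤ) (R : ℕ), ((2 * R + 1 : ℕ) : ℝ) * a β ≤ ℓ₂ →
        ∀ (η : LGConfig 4 G) (y : Fin 4 → ℤ), 0 < ‖siteToE (y - x)‖ * a β →
          (n₀ : ℝ) ≤ ‖siteToE (y - x)‖ → ‖siteToE (y - x)‖ < 3 * siteToE (y - x) 0 →
            K (‖siteToE (y - x)‖ * a β) * ‖siteToE (y - x)‖ ≤ depth (fun j => x j - R) (2 * R + 1) y →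
              c₂ * Γ (‖siteToE (y - x)‖ * a β) ≤
                ‖siteToE (y - x)‖ ^ 8 *
                  kerCov G r β (fun j => x j - R) (2 * R + 1) η (dens G r x) (dens G r y) := by
  haveI := r.secondCountableTopology
  obtain ⟨Γ, β₂, ℓ₂, c₂, K, n₀, hℓ₂, hc₂, hK1, hKanti, hKlim, hn₀, hΓlim, hΓpos, hΓmono, H⟩ := h
  obtain ⟨C₁, β₁, ℓ₁, p, hℓ₁, hC₁, HB⟩ := hFBL
  obtain ⟨M, -, hM⟩ := exists_abs_dens_le G r
  have hθ0 : 0 < θ := lt_of_lt_of_le one_pos hθ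
  -- the enlarged collar
  set A : ℝ := 8 * C₁ ^ 2 / c₂ with hAdef
  have hA : 0 ≤ A := by rw [hAdef]; positivity
  let κ : ℝ → ℝ := fun s => (max 0 (A / Γ (min s ℓ₂))) ^ ((8 : ℕ) : ℝ)⁻¹
  have hκ0 : ∀ s, 0 ≤ κ s := fun s => Real.rpow_nonneg (le_max_left _ _) _
  let K' : ℝ → ℝ := fun s => θ * (K s + κ s + 1)
  have hK'ge' : ∀ s, K s + κ s + 1 ≤ K' s := fun s => by
    show K s + κ s + 1 ≤ θ * (K s + κ s + 1)
    have h0 : 0 ≤ K s + κ s + 1 := by linarith [hK1 s, hκ0 s]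
    nlinarith
  have hK'one : ∀ s, 1 ≤ K' s := fun s => by
    have h2 : (1 : ℝ) ≤ K s + κ s + 1 := by linarith [hK1 s, hκ0 s]
    exact h2.trans (hK'ge' s)
  refine ⟨Γ, max β₁ β₂, min ℓ₁ ℓ₂, c₂ / 2, K', max n₀ (D + 2), lt_min hℓ₁ hℓ₂, by positivity, hK'one, ?_, ?_,
    le_max_of_le_left hn₀, hΓlim, ?_⟩
  · -- antitone
    have hκanti : AntitoneOn κ (Set.Ioi 0) := antitoneOn_collar hA hℓ₂ hΓpos hΓmono
    intro s hs t ht hst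
    have h1 := hKanti hs ht hst
    have h2 := hκanti hs ht hst
    show θ * (K t + κ t + 1) ≤ θ * (K s + κ s + 1)
    exact mul_le_mul_of_nonneg_left (by linarith) hθ0.le
  · -- `s K'(s) → 0`
    have hκlim : Tendsto (fun s : ℝ => s * κ s) (nhdsWithin 0 (Set.Ioi 0)) (nhds 0) :=
      tendsto_mul_collar hA hℓ₂ hΓlim
    have hid : Tendsto (fun s : ℝ => s) (nhdsWithin 0 (Set.Ioi 0)) (nhds 0) :=
      tendsto_id.mono_left nhdsWithin_le_nhds
    have hsum := ((hKlim.add hκlim).add hid).const_mul θ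
    simp only [add_zero, mul_zero] at hsum
    refine hsum.congr' (Eventually.of_forall fun s => ?_)
    show θ * (s * K s + s * κ s + s) = s * (θ * (K s + κ s + 1))
    ring
  -- the main clause
  intro β hβ x R hb η y hspos hn hcone hKy
  have hβ₁ : β₁ ≤ β := le_trans (le_max_left _ _) hβ
  have hβ₂ : β₂ ≤ β := le_trans (le_max_right _ _) hβ
  set ν : ℝ := ‖siteToE (y - x)‖ with hν
  set s : ℝ := ν * a β with hs
  have haβ := ha β
  have hν0 : 0 < ν := by
    rcases (mul_pos_iff.1 hspos) with ⟨h1, _⟩ | ⟨_, h2⟩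
    · exact h1
    · exact absurd haβ (not_lt.2 h2.le)
  have hνn₀ : (n₀ : ℝ) ≤ ν := le_trans (by exact_mod_cast le_max_left n₀ (D + 2)) hn
  have hνD : (D : ℝ) + 2 ≤ ν := by
    have h1 : ((D + 2 : ℕ) : ℝ) ≤ ((max n₀ (D + 2) : ℕ) : ℝ) := Nat.cast_le.2 (le_max_right _ _)
    have h2 : ((D + 2 : ℕ) : ℝ) = (D : ℝ) + 2 := by push_cast; ring
    linarith [h1, h2, hn]
  have hν2 : (2 : ℝ) ≤ ν := by have : (0 : ℝ) ≤ D := Nat.cast_nonneg D; linarith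
  -- depth bookkeeping in the radius-`R` cube
  have hdR : (depth (fun j => x j - R) (2 * R + 1) y : ℝ) ≤ (R : ℝ) + 1 := by
    have h : depth (fun j => x j - R) (2 * R + 1) y ≤ R + 1 := by
      have h' : depth (fun j => x j - R) (2 * R + 1) y ≤
          min (y 0 - (x 0 - R) + 1).toNat ((x 0 - R) + (2 * R + 1 : ℕ) - y 0).toNat := by
        unfold depth
        exact Finset.inf'_le _ (Finset.mem_univ (0 : Fin 4))
      omega
    exact_mod_cast h
  have hK'ν : K' s * ν ≤ (R : ℝ) + 1 := hKy.trans hdR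
  have hsum_le : (K s + κ s + 1) * ν ≤ K' s * ν := mul_le_mul_of_nonneg_right (hK'ge' s) hν0.le
  have hν_le : ν ≤ (K s + κ s + 1) * ν := by
    have h1 : (1 : ℝ) ≤ K s + κ s + 1 := by linarith [hK1 s, hκ0 s]
    calc ν = 1 * ν := (one_mul ν).symm
      _ ≤ (K s + κ s + 1) * ν := mul_le_mul_of_nonneg_right h1 hν0.le
  -- `R ≥ D`
  have hRD : D ≤ R := by
    have : (D : ℝ) ≤ R := by linarith
    exact_mod_cast this
  -- the covering radius `R₀`
  obtain ⟨R₀, hR₀S, hR₀R, hθR⟩ := hcover R hRD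
  have hsub : cubeEdges (fun j => x j - R₀) (2 * R₀ + 1) ⊆ cubeEdges (fun j => x j - R) (2 * R + 1) :=
    cubeEdges_xcentred_subset x hR₀R
  -- femto-ness of the small cube, for (F)_S and for FBL
  have h2R : ((2 * R₀ + 1 : ℕ) : ℝ) ≤ ((2 * R + 1 : ℕ) : ℝ) := by
    exact_mod_cast (by omega : 2 * R₀ + 1 ≤ 2 * R + 1)
  have hb₂ : ((2 * R₀ + 1 : ℕ) : ℝ) * a β ≤ ℓ₂ :=
    ((mul_le_mul_of_nonneg_right h2R haβ.le).trans hb).trans (min_le_right _ _)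
  have hb₁ : ((2 * R₀ + 1 : ℕ) : ℝ) * a β ≤ ℓ₁ :=
    ((mul_le_mul_of_nonneg_right h2R haβ.le).trans hb).trans (min_le_left _ _)
  -- `R₀ + 1 ≥ (K + κ + 1) ν`
  have hR₀ge : (K s + κ s + 1) * ν ≤ (R₀ : ℝ) + 1 := by
    have h1 : θ * ((K s + κ s + 1) * ν) ≤ θ * ((R₀ : ℝ) + 1) := by
      calc θ * ((K s + κ s + 1) * ν) = K' s * ν := by
            show θ * ((K s + κ s + 1) * ν) = θ * (K s + κ s + 1) * ν; ring
        _ ≤ (R : ℝ) + 1 := hK'ν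
        _ ≤ θ * ((R₀ : ℝ) + 1) := hθR
    exact le_of_mul_le_mul_left h1 hθ0
  -- depth of `y` and of `x` in the radius-`R₀` cube
  have hdy : (K s + κ s) * ν ≤ (depth (fun j => x j - R₀) (2 * R₀ + 1) y : ℝ) := by
    have h1 := depth_xcentred_ge x y R₀
    rw [← hν] at h1
    have h2 : (K s + κ s) * ν = (K s + κ s + 1) * ν - ν := by ring
    rw [h2]
    linarith
  have hdx : (R₀ : ℝ) + 1 ≤ (depth (fun j => x j - R₀) (2 * R₀ + 1) x : ℝ) := by
    have := le_depth_cube x x R₀ (t := 0) (fun j => by simp)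
    linarith
  have h1κ : (1 : ℝ) ≤ 1 + κ s := by linarith [hκ0 s]
  have h1κν : 0 < (1 + κ s) * ν := mul_pos (by linarith [hκ0 s]) hν0
  have h1κν2 : (2 : ℝ) ≤ (1 + κ s) * ν := by
    calc (2 : ℝ) = 1 * 2 := by norm_num
      _ ≤ (1 + κ s) * ν := mul_le_mul h1κ hν2 (by norm_num) (by linarith [hκ0 s])
  have hdy' : (1 + κ s) * ν ≤ (depth (fun j => x j - R₀) (2 * R₀ + 1) y : ℝ) := by
    have : (1 + κ s) * ν ≤ (K s + κ s) * ν := mul_le_mul_of_nonneg_right (by linarith [hK1 s]) hν0.le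
    exact this.trans hdy
  have hdx' : (1 + κ s) * ν ≤ (depth (fun j => x j - R₀) (2 * R₀ + 1) x : ℝ) := by
    have : (1 + κ s) * ν ≤ (K s + κ s + 1) * ν :=
      mul_le_mul_of_nonneg_right (by linarith [hK1 s]) hν0.le
    exact this.trans (hR₀ge.trans hdx)
  have h2y : 2 ≤ depth (fun j => x j - R₀) (2 * R₀ + 1) y := by
    have : ((2 : ℕ) : ℝ) ≤ depth (fun j => x j - R₀) (2 * R₀ + 1) y := by
      push_cast; exact h1κν2.trans hdy'
    exact_mod_cast this
  have h2x : 2 ≤ depth (fun j => x j - R₀) (2 * R₀ + 1) x := by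
    have : ((2 : ℕ) : ℝ) ≤ depth (fun j => x j - R₀) (2 * R₀ + 1) x := by
      push_cast; exact h1κν2.trans hdx'
    exact_mod_cast this
  -- the boundary law for the two `R₀`-kernel means, uniformly in the exterior
  set hh : ℝ := C₁ / ((1 + κ s) * ν) ^ 4 with hhh
  have hblx : ∀ ζ : LGConfig 4 G, |kerE G r β (fun j => x j - R₀) (2 * R₀ + 1) ζ (dens G r x) - p β| ≤ hh :=
    fun ζ => (HB β hβ₁ _ _ hb₁ ζ x h2x).trans
      (div_le_div_of_nonneg_left hC₁ (by positivity) (pow_le_pow_left₀ h1κν.le hdx' 4))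
  have hbly : ∀ ζ : LGConfig 4 G, |kerE G r β (fun j => x j - R₀) (2 * R₀ + 1) ζ (dens G r y) - p β| ≤ hh :=
    fun ζ => (HB β hβ₁ _ _ hb₁ ζ y h2y).trans
      (div_le_div_of_nonneg_left hC₁ (by positivity) (pow_le_pow_left₀ h1κν.le hdy' 4))
  -- the floor in the `R₀`-cube, for every exterior
  have hKy₀ : K s * ν ≤ (depth (fun j => x j - R₀) (2 * R₀ + 1) y : ℝ) := by
    have : K s * ν ≤ (K s + κ s) * ν := mul_le_mul_of_nonneg_right (by linarith [hκ0 s]) hν0.le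
    exact this.trans hdy
  have hν8 : 0 < ν ^ 8 := by positivity
  have hfl : ∀ ζ : LGConfig 4 G, c₂ * Γ s / ν ^ 8 ≤
      kerCov G r β (fun j => x j - R₀) (2 * R₀ + 1) ζ (dens G r x) (dens G r y) := by
    intro ζ
    have := H β hβ₂ x R₀ hR₀S hb₂ ζ y hspos hνn₀ hcone hKy₀
    rw [div_le_iff₀ hν8]
    linarith
  -- law of total covariance through the `R₀`-cube
  have htot := kerCov_ge_of_nested G r β hsub η (continuous_dens r x) (continuous_dens r y) (hM x) (hM y)
    hblx hbly hfl
  -- absorption: `4 hh² ≤ (c₂/2) Γ s / ν⁸`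
  have hsℓ₂ : s ≤ ℓ₂ := by
    have h1 : ν ≤ (R : ℝ) + 1 := (hν_le.trans hsum_le).trans hK'ν
    have h2 : (R : ℝ) + 1 ≤ ((2 * R + 1 : ℕ) : ℝ) := by push_cast; linarith
    calc s = ν * a β := rfl
      _ ≤ ((2 * R + 1 : ℕ) : ℝ) * a β := mul_le_mul_of_nonneg_right (h1.trans h2) haβ.le
      _ ≤ ℓ₂ := hb.trans (min_le_right _ _)
  have hs0 : 0 < s := hspos
  have hΓs : 0 < Γ s := hΓpos s hs0 hsℓ₂
  have hκs : κ s = (max 0 (8 * C₁ ^ 2 / (c₂ * Γ s))) ^ ((8 : ℕ) : ℝ)⁻¹ := by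
    show (max 0 (A / Γ (min s ℓ₂))) ^ ((8 : ℕ) : ℝ)⁻¹ = _
    rw [min_eq_left hsℓ₂, hAdef, div_div]
  have habs : 8 * C₁ ^ 2 ≤ c₂ * Γ s * (1 + κ s) ^ 8 := by
    rw [hκs]; exact eight_mul_sq_le_collar hc₂ hΓs
  have h4 : 4 * hh * hh ≤ c₂ * Γ s / 2 / ν ^ 8 := by
    have hpow : ((1 + κ s) * ν) ^ 8 = (1 + κ s) ^ 8 * ν ^ 8 := mul_pow _ _ 8
    have h1κ8 : 0 < (1 + κ s) ^ 8 := by positivity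
    have hden : 0 < ((1 + κ s) * ν) ^ 4 := by positivity
    have hhsq : 4 * hh * hh = 4 * C₁ ^ 2 / ((1 + κ s) ^ 8 * ν ^ 8) := by
      rw [hhh, ← hpow]
      have hD : ((1 + κ s) * ν) ^ 4 ≠ 0 := by positivity
      field_simp
    rw [hhsq, div_le_div_iff₀ (by positivity) hν8]
    calc 4 * C₁ ^ 2 * ν ^ 8 = (8 * C₁ ^ 2) / 2 * ν ^ 8 := by ring
      _ ≤ (c₂ * Γ s * (1 + κ s) ^ 8) / 2 * ν ^ 8 := by gcongr
      _ = c₂ * Γ s / 2 * ((1 + κ s) ^ 8 * ν ^ 8) := by ring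
  -- conclusion
  have hfin : c₂ * Γ s / 2 / ν ^ 8 ≤ kerCov G r β (fun j => x j - R) (2 * R + 1) η (dens G r x) (dens G r y) := by
    have e : c₂ * Γ s / ν ^ 8 - c₂ * Γ s / 2 / ν ^ 8 = c₂ * Γ s / 2 / ν ^ 8 := by ring
    linarith [htot, h4, e]
  rw [div_le_iff₀ hν8] at hfin
  show c₂ / 2 * Γ s ≤ ν ^ 8 * kerCov G r β (fun j => x j - R) (2 * R + 1) η (dens G r x) (dens G r y)
  linarith

/-- **The same with the registered `∀ s₀` collar** (the literal floor clause (F) of `CFPW`, via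
`floorClause_of_antitoneCollar`). [folklore] -/
theorem floorClause_of_cover' (ha : ∀ β, 0 < a β) (hFBL : FBL G r a) (S : Set ℕ) (θ : ℝ) (hθ : 1 ≤ θ) (D : ℕ)
    (hcover : ∀ R : ℕ, D ≤ R → ∃ R₀ ∈ S, R₀ ≤ R ∧ (R : ℝ) + 1 ≤ θ * ((R₀ : ℝ) + 1))
    (h : ∃ (Γ : ℝ → ℝ) (β₂ ℓ₂ c₂ : ℝ) (K : ℝ → ℝ) (n₀ : ℕ), 0 < ℓ₂ ∧ 0 < c₂ ∧ (∀ s, 1 ≤ K s) ∧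
      AntitoneOn K (Set.Ioi 0) ∧ Tendsto (fun s : ℝ => s * K s) (nhdsWithin 0 (Set.Ioi 0)) (nhds 0) ∧ 1 ≤ n₀ ∧
      Tendsto (fun s : ℝ => Γ s / s ^ 8) (nhdsWithin 0 (Set.Ioi 0)) atTop ∧
      (∀ s : ℝ, 0 < s → s ≤ ℓ₂ → 0 < Γ s) ∧ MonotoneOn Γ (Set.Ioc 0 ℓ₂) ∧
      ∀ β : ℝ, β₂ ≤ β → ∀ (x : Fin 4 → ℤ) (R₀ : ℕ), R₀ ∈ S → ((2 * R₀ + 1 : ℕ) : ℝ) * a β ≤ ℓ₂ →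
        ∀ (η : LGConfig 4 G) (y : Fin 4 → ℤ), 0 < ‖siteToE (y - x)‖ * a β →
          (n₀ : ℝ) ≤ ‖siteToE (y - x)‖ → ‖siteToE (y - x)‖ < 3 * siteToE (y - x) 0 →
            K (‖siteToE (y - x)‖ * a β) * ‖siteToE (y - x)‖ ≤ depth (fun j => x j - R₀) (2 * R₀ + 1) y →
              c₂ * Γ (‖siteToE (y - x)‖ * a β) ≤
                ‖siteToE (y - x)‖ ^ 8 *
                  kerCov G r β (fun j => x j - R₀) (2 * R₀ + 1) η (dens G r x) (dens G r y)) :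
    ∃ (Γ : ℝ → ℝ) (β₂ ℓ₂ c₂ : ℝ) (K : ℝ → ℝ) (n₀ : ℕ), 0 < ℓ₂ ∧ 0 < c₂ ∧ (∀ s, 1 ≤ K s) ∧
      Tendsto (fun s : ℝ => s * K s) (nhdsWithin 0 (Set.Ioi 0)) (nhds 0) ∧ 1 ≤ n₀ ∧
      Tendsto (fun s : ℝ => Γ s / s ^ 8) (nhdsWithin 0 (Set.Ioi 0)) atTop ∧
      ∀ β : ℝ, β₂ ≤ β → ∀ (x : Fin 4 → ℤ) (R : ℕ), ((2 * R + 1 : ℕ) : ℝ) * a β ≤ ℓ₂ →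
        ∀ (η : LGConfig 4 G) (y : Fin 4 → ℤ) (s₀ : ℝ), 0 < s₀ → s₀ ≤ ‖siteToE (y - x)‖ * a β →
          (n₀ : ℝ) ≤ ‖siteToE (y - x)‖ → ‖siteToE (y - x)‖ < 3 * siteToE (y - x) 0 →
            K s₀ * ‖siteToE (y - x)‖ ≤ depth (fun j => x j - R) (2 * R + 1) y →
              c₂ * Γ (‖siteToE (y - x)‖ * a β) ≤
                ‖siteToE (y - x)‖ ^ 8 *
                  kerCov G r β (fun j => x j - R) (2 * R + 1) η (dens G r x) (dens G r y) :=
  floorClause_of_antitoneCollar G r a (floorClause_of_cover G r a ha hFBL S θ hθ D hcover h)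

/-- **The floor clause along a geometric sequence of radii.**  If the conditional two-point floor holds on the
x-centred femto cubes of radii `R_k` (unbounded, `R_{k+1} + 1 ≤ θ (R_k + 1)`, `θ ≥ 1` — e.g. the cube sizes of a
multiscale expansion), with an antitone collar and a positive monotone shape with growth, then — given `FBL G r a` —
the registered floor clause (F) holds (constant `c₂/2`). [folklore] -/
theorem floorClause_of_seq (ha : ∀ β, 0 < a β) (hFBL : FBL G r a) (Rs : ℕ → ℕ) (θ : ℝ) (hθ : 1 ≤ θ)
    (hgap : ∀ k, (Rs (k + 1) : ℝ) + 1 ≤ θ * ((Rs k : ℝ) + 1)) (hunb : ∀ R : ℕ, ∃ k, R < Rs k)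
    (h : ∃ (Γ : ℝ → ℝ) (β₂ ℓ₂ c₂ : ℝ) (K : ℝ → ℝ) (n₀ : ℕ), 0 < ℓ₂ ∧ 0 < c₂ ∧ (∀ s, 1 ≤ K s) ∧
      AntitoneOn K (Set.Ioi 0) ∧ Tendsto (fun s : ℝ => s * K s) (nhdsWithin 0 (Set.Ioi 0)) (nhds 0) ∧ 1 ≤ n₀ ∧
      Tendsto (fun s : ℝ => Γ s / s ^ 8) (nhdsWithin 0 (Set.Ioi 0)) atTop ∧
      (∀ s : ℝ, 0 < s → s ≤ ℓ₂ → 0 < Γ s) ∧ MonotoneOn Γ (Set.Ioc 0 ℓ₂) ∧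
      ∀ β : ℝ, β₂ ≤ β → ∀ (x : Fin 4 → ℤ) (k : ℕ), ((2 * Rs k + 1 : ℕ) : ℝ) * a β ≤ ℓ₂ →
        ∀ (η : LGConfig 4 G) (y : Fin 4 → ℤ), 0 < ‖siteToE (y - x)‖ * a β →
          (n₀ : ℝ) ≤ ‖siteToE (y - x)‖ → ‖siteToE (y - x)‖ < 3 * siteToE (y - x) 0 →
            K (‖siteToE (y - x)‖ * a β) * ‖siteToE (y - x)‖ ≤ depth (fun j => x j - Rs k) (2 * Rs k + 1) y →
              c₂ * Γ (‖siteToE (y - x)‖ * a β) ≤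
                ‖siteToE (y - x)‖ ^ 8 *
                  kerCov G r β (fun j => x j - Rs k) (2 * Rs k + 1) η (dens G r x) (dens G r y)) :
    ∃ (Γ : ℝ → ℝ) (β₂ ℓ₂ c₂ : ℝ) (K : ℝ → ℝ) (n₀ : ℕ), 0 < ℓ₂ ∧ 0 < c₂ ∧ (∀ s, 1 ≤ K s) ∧
      Tendsto (fun s : ℝ => s * K s) (nhdsWithin 0 (Set.Ioi 0)) (nhds 0) ∧ 1 ≤ n₀ ∧
      Tendsto (fun s : ℝ => Γ s / s ^ 8) (nhdsWithin 0 (Set.Ioi 0)) atTop ∧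
      ∀ β : ℝ, β₂ ≤ β → ∀ (x : Fin 4 → ℤ) (R : ℕ), ((2 * R + 1 : ℕ) : ℝ) * a β ≤ ℓ₂ →
        ∀ (η : LGConfig 4 G) (y : Fin 4 → ℤ) (s₀ : ℝ), 0 < s₀ → s₀ ≤ ‖siteToE (y - x)‖ * a β →
          (n₀ : ℝ) ≤ ‖siteToE (y - x)‖ → ‖siteToE (y - x)‖ < 3 * siteToE (y - x) 0 →
            K s₀ * ‖siteToE (y - x)‖ ≤ depth (fun j => x j - R) (2 * R + 1) y →
              c₂ * Γ (‖siteToE (y - x)‖ * a β) ≤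
                ‖siteToE (y - x)‖ ^ 8 *
                  kerCov G r β (fun j => x j - R) (2 * R + 1) η (dens G r x) (dens G r y) := by
  obtain ⟨Γ, β₂, ℓ₂, c₂, K, n₀, hℓ₂, hc₂, hK1, hKanti, hKlim, hn₀, hΓlim, hΓpos, hΓmono, H⟩ := h
  refine floorClause_of_cover' G r a ha hFBL (Set.range Rs) θ hθ (Rs 0) (cover_of_seq Rs θ hgap hunb)
    ⟨Γ, β₂, ℓ₂, c₂, K, n₀, hℓ₂, hc₂, hK1, hKanti, hKlim, hn₀, hΓlim, hΓpos, hΓmono, ?_⟩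
  intro β hβ x R₀ hR₀ hb η y hs hn hcone hKy
  obtain ⟨k, rfl⟩ := hR₀
  exact H β hβ x k hb η y hs hn hcone hKy

end Lattice

end Summit.QuantumFields.YangMills.Cruxes.NT.WeakPackage

end
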